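import Mathlib
import Summits.MatrixMultiplication.MatrixMultiplication.Theorems.FidelityWitnessesFidelityGapTwoSixExplicitSides
import Summits.MatrixMultiplication.MatrixMultiplication.Theorems.FidelityWitnessesFidelityGapTwoSixExplicitInputs

/-!
# `FidelityGapTwoSixExplicit` — two frames are never close to one `2`-plane

Part of the proof of `FidelityWitnesses.FidelityGapTwoSixExplicit` (stmt-MatrixMultiplication-14041); see
`FidelityWitnessesFidelityGapTwoSixExplicitDefs.lean` for the line of argument.  Here: the frames
`(u_i ⊗ ĥ)_i` and `(σ(u_w ⊗ ĥ'))_w` are orthonormal pairs with cross Gram mass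
`Σ_{i,w} |⟪σ(u_w ⊗ ĥ'), u_i ⊗ ĥ⟫|² ≤ 1` (Cauchy–Schwarz on `2 × 2` blocks), while a `2`-plane within `1/√50`
of two orthonormal pairs forces cross Gram mass `≥ 2·(18/25) > 1` (`one_lt_cross_of_near`).
-/

noncomputable section

namespace Summit.MatrixMultiplication.MatrixMultiplication.Theorems.GapTwoSixExplicit

-- single-conjunct summit: the `Summit.<S>.<P>` prefix repeats `MatrixMultiplication` by design (D-0017)
set_option linter.dupNamespace false

open scoped BigOperators ComplexConjugate InnerProductSpace
open Literature.Computability.AlgebraicComplexity Module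

/-! ## The two frames `U ⊗ ĥ` and `σ(U ⊗ ĥ')` -/

/-- `U`-components of `u_{i'} ⊗ h`. [folklore] -/
theorem hComp_uTensor (i i' : Fin 2) (h : V8) : hComp i (uTensor i' h) = if i = i' then h else 0 := by
  apply PiLp.ext; intro q
  by_cases hi : i = i'
  · subst hi; simp [hComp, uTensor]
  · simp [hComp, uTensor, hi]

/-- The pair `(u_i ⊗ h)_i` is orthonormal for a unit `h`. [folklore] -/
theorem orthonormal_uTensor {h : V8} (h1 : ‖h‖ = 1) : Orthonormal ℂ (fun i : Fin 2 => uTensor i h) := by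
  rw [orthonormal_iff_ite]
  intro i i'
  rw [inner_uTensor, hComp_uTensor]
  by_cases hi : i = i'
  · subst hi
    rw [if_pos rfl, if_pos rfl]
    have h1' : ((‖h‖ : ℝ) : ℂ) ^ 2 = 1 := by rw [h1]; norm_num
    rw [inner_self_eq_norm_sq_to_K]; exact h1'
  · rw [if_neg hi, if_neg hi, inner_zero_right]

/-- The transported pair `(σ(u_w ⊗ h'))_w` is orthonormal for a unit `h'`. [folklore] -/
theorem orthonormal_sigmaV_uTensor {h' : V8} (h1 : ‖h'‖ = 1) :
    Orthonormal ℂ (fun w : Fin 2 => sigmaV (uTensor w h')) := by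
  have h := orthonormal_uTensor h1
  rw [orthonormal_iff_ite] at h ⊢
  intro w w'
  rw [inner_sigmaV_sigmaV]
  exact h w w'

/-- The `U`-components of `σ(u_i ⊗ h)`: `hComp w (σ(u_i ⊗ h)) (j, (m₁, m₂)) = [m₂ = i] · h (m₁, (j, w))`.
[folklore] -/
theorem hComp_sigmaV_uTensor (w i : Fin 2) (h : V8) (j : Fin 2) (m : P2) :
    hComp w (sigmaV (uTensor i h)) (j, m) = if m.2 = i then h (m.1, (j, w)) else 0 := by
  simp [hComp, uTensor, swapTr]

/-- **Cross Gram bound.**  The two frames `(u_i ⊗ h)_i` and `(σ(u_w ⊗ h'))_w` are far apart: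
`Σ_{i,w} |⟪σ(u_w ⊗ h'), u_i ⊗ h⟫|² ≤ ‖h'‖² ‖h‖²` (Cauchy–Schwarz on `2 × 2` blocks). [folklore] -/
theorem cross_gram_le (h h' : V8) :
    (∑ i : Fin 2, ∑ w : Fin 2, ‖⟪sigmaV (uTensor w h'), uTensor i h⟫_ℂ‖ ^ 2) ≤ ‖h'‖ ^ 2 * ‖h‖ ^ 2 := by
  -- the blocks
  let A : Fin 2 → ℝ := fun i => ∑ q : Fin 2 × Fin 2, ‖h' (q.1, (q.2, i))‖ ^ 2
  let B : Fin 2 → ℝ := fun w => ∑ q : Fin 2 × Fin 2, ‖h (q.2, (q.1, w))‖ ^ 2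
  have hterm : ∀ i w : Fin 2, ‖⟪sigmaV (uTensor w h'), uTensor i h⟫_ℂ‖ ^ 2 ≤ A i * B w := by
    intro i w
    rw [inner_sigmaV_left, inner_uTensor]
    have e : ⟪h', hComp w (sigmaV (uTensor i h))⟫_ℂ
        = ∑ q : Fin 2 × Fin 2, conj (h' (q.1, (q.2, i))) * h (q.2, (q.1, w)) := by
      rw [PiLp.inner_apply, Fintype.sum_prod_type, Fintype.sum_prod_type]
      refine Finset.sum_congr rfl fun j _ => ?_
      rw [Fintype.sum_prod_type, Fin.sum_univ_two, Fin.sum_univ_two, Fin.sum_univ_two]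
      simp only [hComp_sigmaV_uTensor, RCLike.inner_apply']
      fin_cases i <;> simp [mul_comm]
    rw [e]
    have hcs := norm_sq_sum_mul_le (fun q : Fin 2 × Fin 2 => conj (h' (q.1, (q.2, i))))
      (fun q => h (q.2, (q.1, w)))
    simp only [Complex.norm_conj] at hcs
    exact hcs
  have hA : (∑ i, A i) = ‖h'‖ ^ 2 := by
    simp only [A, EuclideanSpace.norm_sq_eq, Fintype.sum_prod_type, Fin.sum_univ_two]
    ring
  have hB : (∑ w, B w) = ‖h‖ ^ 2 := by
    simp only [B, EuclideanSpace.norm_sq_eq, Fintype.sum_prod_type, Fin.sum_univ_two]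
    ring
  calc (∑ i : Fin 2, ∑ w : Fin 2, ‖⟪sigmaV (uTensor w h'), uTensor i h⟫_ℂ‖ ^ 2)
      ≤ ∑ i, ∑ w, A i * B w := Finset.sum_le_sum fun i _ => Finset.sum_le_sum fun w _ => hterm i w
    _ = (∑ i, A i) * ∑ w, B w := by rw [Finset.sum_mul_sum]
    _ = ‖h'‖ ^ 2 * ‖h‖ ^ 2 := by rw [hA, hB]

/-! ## No `2`-plane is close to both frames -/

/-- An elementary inequality: if `x ≤ z + y` (all non-negative) then `(6/7)x² − 6y² ≤ z²`. [folklore] -/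
theorem sq_ge_of_le_add {x y z : ℝ} (hx : 0 ≤ x) (hy : 0 ≤ y) (h : x ≤ z + y) :
    6 / 7 * x ^ 2 - 6 * y ^ 2 ≤ z ^ 2 := by
  by_cases hxy : x ≤ y
  · nlinarith
  · push Not at hxy
    have h1 : x - y ≤ z := by linarith
    have h2 : (x - y) ^ 2 ≤ z ^ 2 := pow_le_pow_left₀ (by linarith) h1 2
    nlinarith [sq_nonneg (x - 7 * y)]

/-- In a subspace of dimension `≥ 2` there is a non-zero vector orthogonal to any given vector.
[folklore] -/
theorem exists_mem_ne_zero_inner_eq_zero {L : Submodule ℂ V16} (hL2 : 2 ≤ finrank ℂ L) (x : V16) :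
    ∃ ℓ ∈ L, ℓ ≠ 0 ∧ ⟪x, ℓ⟫_ℂ = 0 := by
  by_cases hx : x = 0
  · have hne : L ≠ ⊥ := by
      intro h; rw [h, finrank_bot] at hL2; omega
    obtain ⟨ℓ, hℓ, hℓ0⟩ := (Submodule.ne_bot_iff L).1 hne
    exact ⟨ℓ, hℓ, hℓ0, by rw [hx, inner_zero_left]⟩
  · have h1 : finrank ℂ (ℂ ∙ x) = 1 := finrank_span_singleton hx
    have h2 := Submodule.finrank_add_finrank_orthogonal (ℂ ∙ x)
    rw [h1, finrank_euclideanSpace] at h2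
    simp only [Fintype.card_prod, Fintype.card_fin] at h2
    have h3 := Submodule.finrank_sup_add_finrank_inf_eq L (ℂ ∙ x)ᗮ
    have h4 : finrank ℂ (L ⊔ (ℂ ∙ x)ᗮ : Submodule ℂ V16) ≤ 16 := by
      calc finrank ℂ (L ⊔ (ℂ ∙ x)ᗮ : Submodule ℂ V16) ≤ finrank ℂ V16 := Submodule.finrank_le _
        _ = 16 := by rw [finrank_euclideanSpace]; simp
    have h5 : 1 ≤ finrank ℂ (L ⊓ (ℂ ∙ x)ᗮ : Submodule ℂ V16) := by omega
    have hne : (L ⊓ (ℂ ∙ x)ᗮ : Submodule ℂ V16) ≠ ⊥ := by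
      intro h; rw [h, finrank_bot] at h5; omega
    obtain ⟨ℓ, hℓ, hℓ0⟩ := (Submodule.ne_bot_iff _).1 hne
    refine ⟨ℓ, hℓ.1, hℓ0, ?_⟩
    exact hℓ.2 x (Submodule.mem_span_singleton_self x)

/-- **No `2`-plane is close to both frames.**  If `L` has dimension `≥ 2` and is within `1/√50` of
both orthonormal pairs `u` and `g` (`‖ℓ‖² − Σ|⟪·, ℓ⟫|² ≤ ‖ℓ‖²/50` on `L`), then
`Σ_{i,w} |⟪g_w, u_i⟫|² > 1`. [folklore] -/
theorem one_lt_cross_of_near {L : Submodule ℂ V16} (hL2 : 2 ≤ finrank ℂ L) {u g : Fin 2 → V16}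
    (hu : Orthonormal ℂ u) (hg : Orthonormal ℂ g)
    (hA : ∀ ℓ ∈ L, ‖ℓ‖ ^ 2 - ∑ i, ‖⟪u i, ℓ⟫_ℂ‖ ^ 2 ≤ 1 / 50 * ‖ℓ‖ ^ 2)
    (hB : ∀ ℓ ∈ L, ‖ℓ‖ ^ 2 - ∑ w, ‖⟪g w, ℓ⟫_ℂ‖ ^ 2 ≤ 1 / 50 * ‖ℓ‖ ^ 2) :
    1 < ∑ i, ∑ w, ‖⟪g w, u i⟫_ℂ‖ ^ 2 := by
  -- each `u i` captures more than half of the `g`-frame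
  have hhalf : ∀ i : Fin 2, 18 / 25 ≤ ∑ w, ‖⟪g w, u i⟫_ℂ‖ ^ 2 := by
    intro i
    -- the other index
    obtain ⟨i', hi'⟩ : ∃ i' : Fin 2, i' ≠ i ∧ ∀ j : Fin 2, j = i ∨ j = i' := by
      fin_cases i
      · exact ⟨1, by decide, fun j => by fin_cases j <;> simp⟩
      · exact ⟨0, by decide, fun j => by fin_cases j <;> simp⟩
    obtain ⟨ℓ, hℓL, hℓ0, hℓi'⟩ := exists_mem_ne_zero_inner_eq_zero hL2 (u i')
    set c : ℂ := ⟪u i, ℓ⟫_ℂ with hc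
    -- `Σ_j |⟪u j, ℓ⟫|² = |c|²`
    have hsumu : (∑ j, ‖⟪u j, ℓ⟫_ℂ‖ ^ 2) = ‖c‖ ^ 2 := by
      rw [Fin.sum_univ_two]
      rcases hi'.2 0 with h0 | h0 <;> rcases hi'.2 1 with h1 | h1
      · exact absurd (h0.trans h1.symm) (by decide)
      · rw [h0, h1, hℓi', ← hc]; simp
      · rw [h0, h1, hℓi', ← hc]; simp
      · exact absurd (h0.trans h1.symm) (by decide)
    have hℓpos : 0 < ‖ℓ‖ ^ 2 := by positivity
    have hc2 : 49 / 50 * ‖ℓ‖ ^ 2 ≤ ‖c‖ ^ 2 := by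
      have h := hA ℓ hℓL; rw [hsumu] at h; linarith
    have hcℓ : ‖c‖ ≤ ‖ℓ‖ := by
      calc ‖c‖ ≤ ‖u i‖ * ‖ℓ‖ := norm_inner_le_norm _ _
        _ = ‖ℓ‖ := by rw [hu.1 i, one_mul]
    -- the residual
    obtain ⟨-, hres⟩ := residual_facts (hu.1 i) ℓ
    set r : V16 := ℓ - c • u i with hr
    have hr2 : ‖r‖ ^ 2 ≤ 1 / 50 * ‖ℓ‖ ^ 2 := by
      have h := hA ℓ hℓL; rw [hsumu] at h; rw [hres]; exact h
    -- Bessel for `r` in the `g`-frame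
    have hbes : (∑ w, ‖⟪g w, r⟫_ℂ‖ ^ 2) ≤ ‖r‖ ^ 2 := hg.sum_inner_products_le r
    -- `g`-frame on `ℓ`
    have hgl : 49 / 50 * ‖ℓ‖ ^ 2 ≤ ∑ w, ‖⟪g w, ℓ⟫_ℂ‖ ^ 2 := by
      have h := hB ℓ hℓL; linarith
    -- per `w`: `|⟪g w, u i⟫| · |c| ≥ |⟪g w, ℓ⟫| − |⟪g w, r⟫|`
    have hw : ∀ w, 6 / 7 * ‖⟪g w, ℓ⟫_ℂ‖ ^ 2 - 6 * ‖⟪g w, r⟫_ℂ‖ ^ 2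
        ≤ (‖⟪g w, u i⟫_ℂ‖ * ‖c‖) ^ 2 := by
      intro w
      have e : ⟪g w, ℓ⟫_ℂ = ⟪g w, u i⟫_ℂ * c + ⟪g w, r⟫_ℂ := by
        rw [hr, inner_sub_right, inner_smul_right]; ring
      refine sq_ge_of_le_add (norm_nonneg _) (norm_nonneg _) ?_
      rw [e, ← norm_mul]
      exact norm_add_le _ _
    have hsum : 6 / 7 * (49 / 50 * ‖ℓ‖ ^ 2) - 6 * (1 / 50 * ‖ℓ‖ ^ 2)
        ≤ (∑ w, ‖⟪g w, u i⟫_ℂ‖ ^ 2) * ‖c‖ ^ 2 := by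
      have h1 : (∑ w, (6 / 7 * ‖⟪g w, ℓ⟫_ℂ‖ ^ 2 - 6 * ‖⟪g w, r⟫_ℂ‖ ^ 2))
          ≤ ∑ w, (‖⟪g w, u i⟫_ℂ‖ * ‖c‖) ^ 2 := Finset.sum_le_sum fun w _ => hw w
      rw [Finset.sum_sub_distrib, ← Finset.mul_sum, ← Finset.mul_sum] at h1
      have h2 : (∑ w, (‖⟪g w, u i⟫_ℂ‖ * ‖c‖) ^ 2) = (∑ w, ‖⟪g w, u i⟫_ℂ‖ ^ 2) * ‖c‖ ^ 2 := by
        rw [Finset.sum_mul]; refine Finset.sum_congr rfl fun w _ => ?_; ring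
      rw [h2] at h1
      nlinarith [hgl, hbes, hr2]
    -- divide by `|c|² ≤ ‖ℓ‖²`
    have hc2' : ‖c‖ ^ 2 ≤ ‖ℓ‖ ^ 2 := pow_le_pow_left₀ (norm_nonneg _) hcℓ 2
    have hG0 : 0 ≤ ∑ w, ‖⟪g w, u i⟫_ℂ‖ ^ 2 := Finset.sum_nonneg fun w _ => by positivity
    by_contra hlt
    push Not at hlt
    have h3 : (∑ w, ‖⟪g w, u i⟫_ℂ‖ ^ 2) * ‖c‖ ^ 2 < 18 / 25 * ‖ℓ‖ ^ 2 := by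
      calc (∑ w, ‖⟪g w, u i⟫_ℂ‖ ^ 2) * ‖c‖ ^ 2 ≤ (∑ w, ‖⟪g w, u i⟫_ℂ‖ ^ 2) * ‖ℓ‖ ^ 2 :=
            mul_le_mul_of_nonneg_left hc2' hG0
        _ < 18 / 25 * ‖ℓ‖ ^ 2 := mul_lt_mul_of_pos_right hlt hℓpos
    nlinarith
  have h0 := hhalf 0
  have h1 := hhalf 1
  rw [Fin.sum_univ_two]
  linarith

end Summit.MatrixMultiplication.MatrixMultiplication.Theorems.GapTwoSixExplicit

end
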